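import Literature.IUT.HodgeTheaters.SurfaceGroupCompletionTorsionFree
import Mathlib.Algebra.FreeAbelianGroup.Finsupp
import Mathlib.GroupTheory.FreeGroup.NielsenSchreier
import Mathlib.GroupTheory.Schreier
import Mathlib.RingTheory.Finiteness.Cardinality
import HarnessLib

/-!
# Free abelianization coordinates for "a group as in [IUTchI] Theorem 2.6" (free of finite rank / orientable
# surface group) and for its finite-index subgroups

Mochizuki, *Inter-universal Teichmüller theory I* (kurims, May 2020), §2, Thm 2.6 p. 56: "`F` a group that
is either a free discrete group of finite rank or an orientable surface group", and proof of Lemma 2.7 (vi)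
p. 59 / Prop. 2.4 (i) p. 50: "the abelianizations of all open subgroups … are torsion-free"
[cite: Mochizuki2012, Thm 2.6 p.56] (D-0012 claim key; plain combinatorial group theory here, no side taken).
PROOF-ONLY file (seat abc-iut-w5-d119; plan/L5/SUBDAG-IUTchI-Prop24.md row P24i.r4), the DISCRETE input of
`ProfiniteCompletionSurfaceAbelianTorsionFree.lean`: "free abelianization coordinates" on a group `H` = a
surjection `c : H ↠ ℤ^ι` (`Multiplicative (ι →₀ ℤ)`, `ι` finite) through which every homomorphism to a
commutative group factors, stated as an `∃` (no definition introduced):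
* `SurfaceGroup.exists_freeAbelianization` — `S_g ↠ ℤ^{Fin g ⊕ Fin g}` on the standard presentation (the
  surface relator is a product of commutators, `surfaceRelator_lift_eq_one_of_commGroup`);
* `IsOrientableSurfaceGroup.freeAbelianization_of_finiteIndex` — for every finite-index subgroup of an
  orientable surface group, via the tree's THEOREM F_cov `surfaceGroupFiniteIndexSubgroup_holds` and the bridge
  `IsOrientableSurfaceGroup.subgroup_of_finiteIndex`;
* `IsFreeOfFiniteRank.freeAbelianization_of_finiteIndex` — for every finite-index subgroup of a free group of
  finite rank (Schreier + Nielsen–Schreier + `FreeGroupBasis.repr.abelianizationCongr`, as in abc-iut-w4-d055's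
  p418155);
* `IsFreeOrSurface.freeAbelianization_of_finiteIndex` — both.
-/

namespace Literature.IUT.HodgeTheaters

open Literature.GroupTheory.CombinatorialGroupTheory (SurfaceGroupFiniteIndexSubgroup
  surfaceGroupFiniteIndexSubgroup_holds)

universe u

/-- **The abelianization of the surface group `S_g` is free abelian on its `2g` standard generators**, in
the coordinate form used above: a surjection `c : S_g ↠ ℤ^{Fin g ⊕ Fin g}` with `c(a_i) = e_{inl i}`,
`c(b_i) = e_{inr i}`, through which every homomorphism to a commutative group factors (the surface
relator `∏ [a_i, b_i]` dies in every commutative group, `surfaceRelator_lift_eq_one_of_commGroup`).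
[cite: Mochizuki2012, Thm 2.6 p.56] -/
theorem SurfaceGroup.exists_freeAbelianization (g : ℕ) :
    ∃ c : SurfaceGroup g →* Multiplicative (Fin g ⊕ Fin g →₀ ℤ),
      (∀ x, c (PresentedGroup.of x) = Multiplicative.ofAdd (Finsupp.single x 1)) ∧
      Function.Surjective c ∧
      ∀ (A : Type u) [CommGroup A] (f : SurfaceGroup g →* A) (h : SurfaceGroup g), c h = 1 → f h = 1 := by
  classical
  let gen : Fin g ⊕ Fin g → Multiplicative (Fin g ⊕ Fin g →₀ ℤ) :=
    fun x => Multiplicative.ofAdd (Finsupp.single x 1)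
  have hrel : ∀ r ∈ ({surfaceRelator g} : Set (FreeGroup (Fin g ⊕ Fin g))),
      FreeGroup.lift gen r = 1 := by
    intro r hr
    rw [Set.mem_singleton_iff] at hr
    subst hr
    exact surfaceRelator_lift_eq_one_of_commGroup g gen
  let c : SurfaceGroup g →* Multiplicative (Fin g ⊕ Fin g →₀ ℤ) := PresentedGroup.toGroup hrel
  have hc : ∀ x, c (PresentedGroup.of x) = Multiplicative.ofAdd (Finsupp.single x 1) := fun x =>
    PresentedGroup.toGroup.of hrel
  refine ⟨c, hc, ?_, ?_⟩
  · -- surjective: the range contains every `single a b = b • e_a`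
    suffices hall : ∀ f : Fin g ⊕ Fin g →₀ ℤ, Multiplicative.ofAdd f ∈ c.range by
      intro m
      obtain ⟨h, hh⟩ := hall (Multiplicative.toAdd m)
      exact ⟨h, by rw [hh, ofAdd_toAdd]⟩
    intro f
    induction f using Finsupp.induction_linear with
    | zero => exact ⟨1, by rw [map_one, ofAdd_zero]⟩
    | add f₁ f₂ h₁ h₂ => rw [ofAdd_add]; exact c.range.mul_mem h₁ h₂
    | single a b =>
      exact ⟨PresentedGroup.of a ^ b, by rw [map_zpow, hc, ← ofAdd_zsmul, Finsupp.smul_single_one]⟩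
  · -- every homomorphism to a commutative group factors through `c`
    intro A _ f h hch
    let F : Multiplicative (Fin g ⊕ Fin g →₀ ℤ) →* A :=
      AddMonoidHom.toMultiplicativeLeft
        (Finsupp.liftAddHom fun x => zmultiplesHom (Additive A) (Additive.ofMul (f (PresentedGroup.of x))))
    have hF : ∀ x, F (Multiplicative.ofAdd (Finsupp.single x 1)) = f (PresentedGroup.of x) := by
      intro x
      change Additive.toMul (Finsupp.liftAddHom _ (Finsupp.single x 1)) = _
      rw [Finsupp.liftAddHom_apply_single, zmultiplesHom_apply, one_zsmul, toMul_ofMul]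
    have hfac : f = F.comp c := PresentedGroup.ext fun x => by rw [MonoidHom.comp_apply, hc, hF]
    rw [hfac, MonoidHom.comp_apply, hch, map_one]

/-- Free abelianization coordinates transport along a group isomorphism. [folklore] -/
private theorem freeAbelianization_of_mulEquiv {H : Type u} [Group H] {K : Type*} [Group K]
    (e : H ≃* K) {ι : Type} [Finite ι] (cK : K →* Multiplicative (ι →₀ ℤ))
    (hsurj : Function.Surjective cK)
    (hker : ∀ (A : Type u) [CommGroup A] (f : K →* A) (k : K), cK k = 1 → f k = 1) :
    ∃ (ι : Type u) (_ : Finite ι) (c : H →* Multiplicative (ι →₀ ℤ)), Function.Surjective c ∧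
      ∀ (A : Type u) [CommGroup A] (f : H →* A) (h : H), c h = 1 → f h = 1 := by
  -- re-index along `ι ≃ ULift ι` to land in `Type u`
  let L : Multiplicative (ι →₀ ℤ) ≃* Multiplicative (ULift.{u} ι →₀ ℤ) :=
    AddEquiv.toMultiplicative
      (Finsupp.domCongr (Equiv.ulift.{u, 0} (α := ι)).symm : (ι →₀ ℤ) ≃+ (ULift.{u} ι →₀ ℤ))
  refine ⟨ULift.{u} ι, inferInstance, L.toMonoidHom.comp (cK.comp e.toMonoidHom),
    L.surjective.comp (hsurj.comp e.surjective), ?_⟩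
  intro A _ f h hch
  have hch' : cK (e h) = 1 := by
    have : L (cK (e h)) = L 1 := by rw [map_one]; exact hch
    exact L.injective this
  have := hker A (f.comp e.symm.toMonoidHom) (e h) hch'
  simpa only [MonoidHom.comp_apply, MulEquiv.coe_toMonoidHom, MulEquiv.symm_apply_apply] using this

/-- **`hab` for orientable surface groups**: every finite-index subgroup `H` of an orientable surface group
`G` has free abelianization of finite rank — `H` is itself an orientable surface group `S_h` (F_cov =
`surfaceGroupFiniteIndexSubgroup_holds`, Zieschang–Vogt–Coldewey 4.14.22, a THEOREM of the tree, through the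
bridge `IsOrientableSurfaceGroup.subgroup_of_finiteIndex`) and `S_h^{ab} ≅ ℤ^{2h}`
(`SurfaceGroup.exists_freeAbelianization`). [cite: Mochizuki2012, Thm 2.6 p.56] -/
theorem IsOrientableSurfaceGroup.freeAbelianization_of_finiteIndex {G : Type u} [Group G]
    (hG : IsOrientableSurfaceGroup G) (H : Subgroup G) (hH : H.FiniteIndex) :
    ∃ (ι : Type u) (_ : Finite ι) (c : H →* Multiplicative (ι →₀ ℤ)), Function.Surjective c ∧
      ∀ (A : Type u) [CommGroup A] (f : H →* A) (h : H), c h = 1 → f h = 1 := by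
  haveI := hH
  obtain ⟨g, -, ⟨e⟩⟩ := hG.subgroup_of_finiteIndex surfaceGroupFiniteIndexSubgroup_holds H
  obtain ⟨cK, -, hsurj, hker⟩ := SurfaceGroup.exists_freeAbelianization.{u} g
  exact freeAbelianization_of_mulEquiv e cK hsurj hker

/-- A finitely generated free group has a FINITE free basis (its abelianization `≅ ℤ^{(ι)}` is a finitely
generated `ℤ`-module) — as in p418155. [folklore] -/
private theorem finite_generators_of_fg' (H : Type u) [Group H] [IsFreeGroup H] [Group.FG H] :
    Finite (IsFreeGroup.Generators H) := by
  let b : FreeGroupBasis (IsFreeGroup.Generators H) H := IsFreeGroup.basis H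
  let e₁ : Additive (Abelianization H) ≃+ FreeAbelianGroup (IsFreeGroup.Generators H) :=
    MulEquiv.toAdditive b.repr.abelianizationCongr
  let e₂ : FreeAbelianGroup (IsFreeGroup.Generators H) ≃+ (IsFreeGroup.Generators H →₀ ℤ) :=
    FreeAbelianGroup.equivFinsupp _
  have hof : Function.Surjective (Abelianization.of : H →* Abelianization H) :=
    QuotientGroup.mk_surjective
  haveI : Group.FG (Abelianization H) := Group.fg_of_surjective hof
  haveI : Module.Finite ℤ (Additive (Abelianization H)) := Module.Finite.iff_addGroup_fg.2 inferInstance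
  haveI : Module.Finite ℤ (IsFreeGroup.Generators H →₀ ℤ) :=
    Module.Finite.equiv (e₁.trans e₂).toIntLinearEquiv
  exact Module.Finite.finite_basis (Finsupp.basisSingleOne (R := ℤ) (ι := IsFreeGroup.Generators H))

/-- **`hab` for free groups of finite rank** (as in p418155: a finite-index subgroup of `F_n` is finitely
generated (Schreier) and free (Nielsen–Schreier), so its abelianization is `ℤ^ι` with `ι` finite —
coordinates = `FreeGroupBasis.repr.abelianizationCongr`). [cite: Mochizuki2012, Thm 2.6 p.56] -/
theorem IsFreeOfFiniteRank.freeAbelianization_of_finiteIndex {G : Type u} [Group G]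
    (hG : IsFreeOfFiniteRank G) (H : Subgroup G) (hH : H.FiniteIndex) :
    ∃ (ι : Type u) (_ : Finite ι) (c : H →* Multiplicative (ι →₀ ℤ)), Function.Surjective c ∧
      ∀ (A : Type u) [CommGroup A] (f : H →* A) (h : H), c h = 1 → f h = 1 := by
  classical
  haveI := hH
  obtain ⟨n, ⟨eG⟩⟩ := hG
  haveI : IsFreeGroup G := IsFreeGroup.ofMulEquiv eG.symm
  haveI : Group.FG G := by
    haveI : Group.FG (FreeGroup (Fin n)) := inferInstance
    exact Group.fg_of_surjective (f := eG.symm.toMonoidHom) eG.symm.surjective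
  haveI : Group.FG H := Subgroup.fg_of_index_ne_zero H
  -- `H` is free (Nielsen–Schreier) on a finite basis
  let ι := IsFreeGroup.Generators H
  haveI : Finite ι := finite_generators_of_fg' H
  let b : FreeGroupBasis ι H := IsFreeGroup.basis H
  let E : Additive (Abelianization H) ≃+ (ι →₀ ℤ) :=
    (MulEquiv.toAdditive b.repr.abelianizationCongr).trans (FreeAbelianGroup.equivFinsupp ι)
  let E' : Abelianization H ≃* Multiplicative (ι →₀ ℤ) := AddEquiv.toMultiplicativeRight E
  let c : H →* Multiplicative (ι →₀ ℤ) := E'.toMonoidHom.comp (Abelianization.of (G := H))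
  refine ⟨ι, inferInstance, c, E'.surjective.comp QuotientGroup.mk_surjective, ?_⟩
  intro A _ f h hch
  have h1 : Abelianization.of h = 1 := by
    have : E' (Abelianization.of h) = E' 1 := by rw [map_one]; exact hch
    exact E'.injective this
  rw [← Abelianization.lift_apply_of f h, h1, map_one]

/-- **Free abelianization coordinates for the finite-index subgroups of "a group as in Theorem 2.6".**
[cite: Mochizuki2012, Thm 2.6 p.56] -/
theorem IsFreeOrSurface.freeAbelianization_of_finiteIndex {G : Type u} [Group G]
    (hG : IsFreeOrSurface G) (H : Subgroup G) (hH : H.FiniteIndex) :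
    ∃ (ι : Type u) (_ : Finite ι) (c : H →* Multiplicative (ι →₀ ℤ)), Function.Surjective c ∧
      ∀ (A : Type u) [CommGroup A] (f : H →* A) (h : H), c h = 1 → f h = 1 := by
  rcases hG with hF | hS
  · exact hF.freeAbelianization_of_finiteIndex H hH
  · exact hS.freeAbelianization_of_finiteIndex H hH

end Literature.IUT.HodgeTheaters
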